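import Mathlib.GroupTheory.Index
import Mathlib.GroupTheory.Coset.Basic
import Mathlib.LinearAlgebra.Dimension.Finrank
import Mathlib.LinearAlgebra.Dimension.Constructions
import Mathlib.LinearAlgebra.FiniteDimensional.Defs
import Mathlib.LinearAlgebra.FiniteDimensional.Lemmas
import Mathlib.LinearAlgebra.FreeModule.Finite.Quotient
import Mathlib.LinearAlgebra.Projection
import Mathlib.RingTheory.Noetherian.Basic
import Mathlib.Tactic.Group
import Mathlib.Tactic.Abel
import HarnessLib

/-!
# Route LinearSystemTorelli — crux `LocalTubeSpan` (stmt-HodgeConjecture-2490): generic lemmas for the frame lift (Lemma 11 for degenerate lattices)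

Helper file (`--supports stmt-HodgeConjecture-2490`, line `Sketch` of the crux chain, cycle 6,
continuation lead c5; first half of the lead's stub `stub_frameLift`).

Cycle 6 proves Schnell's Lemma 11 ([Schnell2010] §7) for arbitrary, possibly DEGENERATE, skew
vanishing lattices from its nondegenerate case: a frame of the nondegenerate quotient `V / R`
(`R = ker B` the radical) LIFTS.  This file holds the vocabulary-free lemmas of that argument:

* `localTubeSpan_finiteIndex_of_latticeCount` — THE COUNTING LEMMA: a subgroup `A ≤ N` of a group
  carrying an injective multiplicative-to-additive map `Φ : N → E` into a finitely generated free
  `ℤ`-lattice `L` of rank `≤ d` has finite index as soon as `Φ(A)` contains `d` `ℤ`-linearly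
  independent vectors (equal ranks ⇒ finite quotient, `Submodule.finiteQuotientOfFreeOfRankEq`,
  and `N ⧸ Φ⁻¹(span) ↪ L ⧸ span`);
* `localTubeSpan_exists_linearIndependent_of_span_eq_top` — a spanning subset of a
  finite-dimensional space contains `dim` linearly independent vectors, as a `Fin`-family;
* `localTubeSpan_mem_sup_decomp` — elements of `H ⊔ N` are products `h * n` when `H` normalises `N`;
* `localTubeSpan_shear_of_trivial_mod` — THE SHEAR FORMULA: if `h (u x) = x - c(x) (w + β)` with
  `h` preserving a complement `V₀ ∋ w` of `R ∋ β` and fixing `R`, and `u ≡ 1 (mod R)`, then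
  `u x - x = -c(x) β`;
* `localTubeSpan_conj_shear` — conjugating such a shear by an isometry fixing `β` moves the cycle.

No named facts; no `sorry`.
-/

-- `Summit.HodgeConjecture.HodgeConjecture.Theorems` is the mandated namespace (single-conjunct summit:
-- Sub = Summit), which `linter.dupNamespace` flags on every declaration; the lakefile turns the
-- linter off tree-wide (weak option), restated here so stand-alone elaboration is warning-free too.
set_option linter.dupNamespace false

noncomputable section

namespace Summit.HodgeConjecture.HodgeConjecture.Theorems

/-! ### The counting lemma -/

/-- **Counting lemma (finite index from equal lattice ranks).**  Let `A ≤ N` be a subgroup of a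
group, `Φ : N → E` an injective map into an additive group turning products into sums, with values
in a finitely generated free `ℤ`-submodule `L` of rank at most `d`.  If `Φ(A)` contains a
`ℤ`-linearly independent family of `d` vectors, then `A` has finite index in `N`: the `ℤ`-span `S` of
the family has the same rank as `L`, so `L ⧸ S` is finite, and `n ↦ Φ n` induces an injection of
`N ⧸ A₀` into `L ⧸ S` for the subgroup `A₀ = Φ⁻¹(S) ≤ A`. [folklore] -/
theorem localTubeSpan_finiteIndex_of_latticeCount {N : Type*} [Group N] (A : Subgroup N)
    {E : Type*} [AddCommGroup E] (Φ : N → E) (hΦmul : ∀ a b, Φ (a * b) = Φ a + Φ b)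
    (hΦinj : Function.Injective Φ) (L : Submodule ℤ E) [Module.Free ℤ L] [Module.Finite ℤ L]
    {d : ℕ} (hLd : Module.finrank ℤ L ≤ d) (hΦL : ∀ n, Φ n ∈ L)
    {ι : Type*} [Fintype ι] (hcard : Fintype.card ι = d) (fam : ι → E)
    (hfam : LinearIndependent ℤ fam) (hfamA : ∀ i, ∃ a ∈ A, Φ a = fam i) :
    A.FiniteIndex := by
  classical
  -- `Φ 1 = 0` and `Φ a⁻¹ = -Φ a`
  have hΦone : Φ 1 = 0 := by
    have h := hΦmul 1 1
    rw [mul_one] at h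
    exact (add_left_cancel (a := Φ 1) (b := 0) (c := Φ 1) (by rw [add_zero, ← h])).symm
  have hΦinv : ∀ a, Φ a⁻¹ = -Φ a := fun a => by
    have h := hΦmul a a⁻¹
    rw [mul_inv_cancel, hΦone] at h
    exact (neg_eq_of_add_eq_zero_right h.symm).symm
  -- the family inside `L`, and its span `S ≤ L`
  have hfamL : ∀ i, fam i ∈ L := fun i => by
    obtain ⟨a, -, ha⟩ := hfamA i
    rw [← ha]; exact hΦL a
  let famL : ι → L := fun i => ⟨fam i, hfamL i⟩
  have hfamL_li : LinearIndependent ℤ famL :=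
    LinearIndependent.of_comp L.subtype (by simpa [famL, Function.comp_def] using hfam)
  set S : Submodule ℤ L := Submodule.span ℤ (Set.range famL) with hSdef
  -- equal ranks
  haveI : IsNoetherian ℤ L := isNoetherian_of_isNoetherianRing_of_finite ℤ L
  haveI : Module.Finite ℤ S := Module.IsNoetherian.finite ℤ S
  have hfamS_li : LinearIndependent ℤ (fun i => (⟨famL i, Submodule.subset_span ⟨i, rfl⟩⟩ : S)) :=
    LinearIndependent.of_comp S.subtype
      (by simpa [Function.comp_def] using hfamL_li)
  have hrank : Module.finrank ℤ S = Module.finrank ℤ L := by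
    refine le_antisymm (Submodule.finrank_le S) ?_
    calc Module.finrank ℤ L ≤ d := hLd
      _ = Fintype.card ι := hcard.symm
      _ ≤ Module.finrank ℤ S := hfamS_li.fintype_card_le_finrank
  haveI hfin : Finite (L ⧸ S) := Submodule.finiteQuotientOfFreeOfRankEq S hrank
  -- `S` (in `E`) lies in `Φ(A)`
  have hSA : ∀ x ∈ S, ∃ a ∈ A, Φ a = (x : E) := by
    intro x hx
    rw [hSdef] at hx
    induction hx using Submodule.span_induction with
    | mem x hx =>
      obtain ⟨i, rfl⟩ := hx
      exact hfamA i
    | zero => exact ⟨1, A.one_mem, by rw [hΦone]; rfl⟩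
    | add x y _ _ hx hy =>
      obtain ⟨a, ha, hax⟩ := hx
      obtain ⟨b, hb, hby⟩ := hy
      exact ⟨a * b, A.mul_mem ha hb, by rw [hΦmul, hax, hby]; rfl⟩
    | smul n x _ hx =>
      obtain ⟨a, ha, hax⟩ := hx
      refine ⟨a ^ n, A.zpow_mem ha n, ?_⟩
      have hpow : ∀ m : ℕ, Φ (a ^ m) = m • Φ a := fun m => by
        induction m with
        | zero => rw [pow_zero, hΦone, zero_smul]
        | succ m ih => rw [pow_succ, hΦmul, ih, succ_nsmul]
      rcases n with n | n
      · rw [Int.ofNat_eq_natCast, zpow_natCast, hpow, Submodule.coe_smul, ← hax, natCast_zsmul]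
      · rw [zpow_negSucc, hΦinv, hpow, Submodule.coe_smul, ← hax, negSucc_zsmul]
  -- the subgroup `A₀ = Φ⁻¹(S) ≤ A`
  let A₀ : Subgroup N :=
    { carrier := {n | ∃ x ∈ S, (x : E) = Φ n}
      one_mem' := ⟨0, S.zero_mem, by rw [hΦone]; rfl⟩
      mul_mem' := by
        rintro a b ⟨x, hx, hxa⟩ ⟨y, hy, hyb⟩
        exact ⟨x + y, S.add_mem hx hy, by rw [hΦmul, ← hxa, ← hyb]; rfl⟩
      inv_mem' := by
        rintro a ⟨x, hx, hxa⟩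
        exact ⟨-x, S.neg_mem hx, by rw [hΦinv, ← hxa]; rfl⟩ }
  have hA₀A : A₀ ≤ A := by
    rintro n ⟨x, hx, hxn⟩
    obtain ⟨a, ha, hax⟩ := hSA x hx
    rw [← hax] at hxn
    exact hΦinj hxn ▸ ha
  -- `N ⧸ A₀ ↪ L ⧸ S`
  let ψ₀ : N → L ⧸ S := fun n => Submodule.Quotient.mk ⟨Φ n, hΦL n⟩
  letI : Setoid N := QuotientGroup.leftRel A₀
  have hψ₀ : ∀ a b : N, a ≈ b → ψ₀ a = ψ₀ b := by
    intro a b hab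
    have hab' : a⁻¹ * b ∈ A₀ := QuotientGroup.leftRel_apply.1 hab
    obtain ⟨x, hx, hxab⟩ := hab'
    rw [hΦmul, hΦinv] at hxab
    refine (Submodule.Quotient.eq S).2 ?_
    have : (⟨Φ a, hΦL a⟩ : L) - ⟨Φ b, hΦL b⟩ = -x := by
      refine Subtype.ext ?_
      change Φ a - Φ b = -(x : E)
      rw [hxab]; abel
    rw [this]
    exact S.neg_mem hx
  let ψ : N ⧸ A₀ → L ⧸ S := Quotient.lift ψ₀ hψ₀
  have hψinj : Function.Injective ψ := by
    intro p q hpq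
    induction p using QuotientGroup.induction_on with
    | H a =>
      induction q using QuotientGroup.induction_on with
      | H b =>
        change ψ₀ a = ψ₀ b at hpq
        refine QuotientGroup.eq.2 ?_
        have hmem : (⟨Φ a, hΦL a⟩ : L) - ⟨Φ b, hΦL b⟩ ∈ S := (Submodule.Quotient.eq S).1 hpq
        refine ⟨-((⟨Φ a, hΦL a⟩ : L) - ⟨Φ b, hΦL b⟩), S.neg_mem hmem, ?_⟩
        change -(Φ a - Φ b) = Φ (a⁻¹ * b)
        rw [hΦmul, hΦinv]; abel
  haveI : Finite (N ⧸ A₀) := Finite.of_injective ψ hψinj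
  haveI : A₀.FiniteIndex := Subgroup.finiteIndex_of_finite_quotient
  exact Subgroup.finiteIndex_of_le hA₀A

/-! ### Independent vectors inside a spanning set -/

/-- A spanning subset of a finite-dimensional vector space contains `dim` linearly independent
vectors, packaged as a family indexed by `Fin r`, `r = dim`. [folklore] -/
theorem localTubeSpan_exists_linearIndependent_of_span_eq_top {K W : Type*} [Field K]
    [AddCommGroup W] [Module K W] [FiniteDimensional K W] (O : Set W)
    (hO : Submodule.span K O = ⊤) {r : ℕ} (hr : r = Module.finrank K W) :
    ∃ f : Fin r → W, (∀ i, f i ∈ O) ∧ LinearIndependent K f := by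
  obtain ⟨b, hbO, hbspan, hbli⟩ := exists_linearIndependent K O
  have hbfin : b.Finite := hbli.set_finite_of_isNoetherian
  obtain ⟨n, f, hf⟩ := hbfin.fin_embedding
  have hfli : LinearIndependent K f := by
    rw [← linearIndepOn_id_range_iff f.injective, hf]
    exact hbli
  have hn : n = r := by
    have htop : Submodule.span K (Set.range f) = ⊤ := by rw [hf, hbspan, hO]
    have h1 := hfli.fintype_card_le_finrank
    have h2 := finrank_le_of_span_eq_top htop
    rw [Fintype.card_fin] at h1 h2
    omega
  subst hn
  exact ⟨f, fun i => hbO (hf ▸ Set.mem_range_self i), hfli⟩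

/-! ### Elements of `H ⊔ N` when `H` normalises `N` -/

/-- If the subgroup `H` normalises the subgroup `N`, every element of `H ⊔ N` is a product `h * n`.
[folklore] -/
theorem localTubeSpan_mem_sup_decomp {G : Type*} [Group G] (H N : Subgroup G)
    (hnorm : ∀ h ∈ H, ∀ n ∈ N, h * n * h⁻¹ ∈ N) {x : G} (hx : x ∈ H ⊔ N) :
    ∃ h ∈ H, ∃ n ∈ N, x = h * n := by
  rw [Subgroup.sup_eq_closure] at hx
  induction hx using Subgroup.closure_induction with
  | mem y hy =>
    rcases hy with hy | hy
    · exact ⟨y, hy, 1, N.one_mem, (mul_one y).symm⟩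
    · exact ⟨1, H.one_mem, y, hy, (one_mul y).symm⟩
  | one => exact ⟨1, H.one_mem, 1, N.one_mem, (mul_one 1).symm⟩
  | mul y z _ _ ihy ihz =>
    obtain ⟨h₁, hh₁, n₁, hn₁, rfl⟩ := ihy
    obtain ⟨h₂, hh₂, n₂, hn₂, rfl⟩ := ihz
    refine ⟨h₁ * h₂, H.mul_mem hh₁ hh₂, (h₂⁻¹ * n₁ * h₂) * n₂,
      N.mul_mem (by simpa using hnorm h₂⁻¹ (H.inv_mem hh₂) n₁ hn₁) hn₂, by group⟩
  | inv y _ ih =>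
    obtain ⟨h, hh, n, hn, rfl⟩ := ih
    exact ⟨h⁻¹, H.inv_mem hh, h * n⁻¹ * h⁻¹, hnorm h hh n⁻¹ (N.inv_mem hn), by group⟩

/-! ### The shear formula -/

section Shear

variable {K V : Type*} [Field K] [AddCommGroup V] [Module K V]

/-- **The shear formula.**  Let `V₀, R ≤ V` be submodules with `V₀ ⊓ R = ⊥` such that every
vector decomposes as `x₀ + r`; let `h` be a linear map preserving `V₀` and fixing `R` pointwise, and
`u`, `T` maps with `h (u x) = T x = x - c(x) • (w + β)` (`w ∈ V₀`, `β ∈ R`).  If `u ≡ 1 (mod R)`,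
then `u x - x = -c(x) • β` for every `x`: the `V₀`-component of `u x - x` is forced to vanish.
(In the frame lift: `h` in the lifted frame group, `T = T_e^m` a power of the transvection along a
new basis vector `e = w + β`, `u = h⁻¹ T_e^m` a unipotent element of the monodromy group.)
[folklore] -/
theorem localTubeSpan_shear_of_trivial_mod (V₀ R : Submodule K V) (hdisj : V₀ ⊓ R = ⊥)
    (hdec : ∀ x : V, ∃ x₀ ∈ V₀, ∃ r ∈ R, x = x₀ + r)
    (h : V →ₗ[K] V) (hhV₀ : ∀ x ∈ V₀, h x ∈ V₀) (hhR : ∀ r ∈ R, h r = r)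
    (u T : V → V) (c : V → K) {w β : V} (hw : w ∈ V₀) (hβ : β ∈ R)
    (hT : ∀ x, T x = x - c x • (w + β)) (hu : ∀ x, h (u x) = T x)
    (huR : ∀ x, u x - x ∈ R) (x : V) :
    u x - x = -(c x • β) := by
  obtain ⟨x₀, hx₀, r, hr, rfl⟩ := hdec x
  have hρR : u (x₀ + r) - (x₀ + r) ∈ R := huR _
  -- `h (u x) = h x + (u x - x)` because `u x - x ∈ R` is fixed by `h`
  have e1 : h (u (x₀ + r)) = h (x₀ + r) + (u (x₀ + r) - (x₀ + r)) := by
    conv_lhs => rw [show u (x₀ + r) = (x₀ + r) + (u (x₀ + r) - (x₀ + r)) by abel]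
    rw [map_add h (x₀ + r), hhR _ hρR]
  rw [hu, hT, map_add, hhR r hr] at e1
  -- `e1 : x₀ + r - c • (w + β) = h x₀ + r + (u (x₀ + r) - (x₀ + r))`
  have e2 : u (x₀ + r) - (x₀ + r) = (x₀ + r - c (x₀ + r) • (w + β)) - h x₀ - r := by
    rw [e1]; abel
  -- so `(u x - x) + c • β = (x₀ - c • w) - h x₀` lies in `V₀ ∩ R = 0`
  have e3 : (u (x₀ + r) - (x₀ + r)) + c (x₀ + r) • β = (x₀ - c (x₀ + r) • w) - h x₀ := by
    rw [e2, smul_add]; abel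
  have hV : (u (x₀ + r) - (x₀ + r)) + c (x₀ + r) • β ∈ V₀ := by
    rw [e3]
    exact V₀.sub_mem (V₀.sub_mem hx₀ (V₀.smul_mem _ hw)) (hhV₀ x₀ hx₀)
  have hRm : (u (x₀ + r) - (x₀ + r)) + c (x₀ + r) • β ∈ R := R.add_mem hρR (R.smul_mem _ hβ)
  have h0 : (u (x₀ + r) - (x₀ + r)) + c (x₀ + r) • β = 0 := by
    have : (u (x₀ + r) - (x₀ + r)) + c (x₀ + r) • β ∈ V₀ ⊓ R := ⟨hV, hRm⟩
    rwa [hdisj, Submodule.mem_bot] at this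
  exact eq_neg_of_add_eq_zero_left h0

/-- **Conjugating a shear by an isometry.**  If `u x - x = -(a · B(x, e)) • β` for all `x`, and
`g` is an invertible isometry of `B` fixing `β`, then `(g u g⁻¹) x - x = -(a · B(x, g e)) • β`.
[folklore] -/
theorem localTubeSpan_conj_shear (B : LinearMap.BilinForm K V) (g ginv u : V →ₗ[K] V)
    (hg : ∀ x y, B (g x) (g y) = B x y) (hginv : ∀ x, g (ginv x) = x) (a : K) (e β : V)
    (hgβ : g β = β) (hu : ∀ x, u x - x = -((a * B x e) • β)) (x : V) :
    g (u (ginv x)) - x = -((a * B x (g e)) • β) := by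
  have e1 : g (u (ginv x)) - x = g (u (ginv x) - ginv x) := by
    rw [map_sub, hginv]
  rw [e1, hu, map_neg, map_smul, hgβ, ← hg (ginv x) e, hginv]

end Shear

end Summit.HodgeConjecture.HodgeConjecture.Theorems

end
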